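import Summits.CriticalPhenomena.PercolationContinuityZ3.Theorems.PercNearOneGluingNoHeavyLowerTailSahiCTCLadderRowTopT
import HarnessLib

/-!
# `NoHeavyLowerTail` (crux stmt-CriticalPhenomena-4575), P3 lane: a TRIPLED point of the ladder `(L_t)` is the ladder `(L_{t−1})` of the links

Support file (seat `prim-l12-p3`, gen 26; `--supports stmt-CriticalPhenomena-4575`).  Memo g26 §3 (Theorem C).  For up-sets `𝒳, 𝒵` and a point `b`
let `upFam b 𝒳 = {U : U ∪ {b} ∈ 𝒳}` (the link at `b`, as an up-set of the same type; `(t−1)`-live when `𝒳` is `t`-live).  For a profile `m`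
with `m b = 3` (and `m ≤ 3`) and `m' = m − 3·1_b`:
* `coeff_ee_mul_harris_triple` — `[m](e_t·H(𝒳,𝒵)) = [m'](e_{t−1}·H(upFam b 𝒳, upFam b 𝒵))` (the cubes with `b` in the peeled `t`-set are
  the cubes of the links; the others vanish);
* `coeff_charge_triple` — `[m](Θ_{t−1}e_{≥t}GF(W_t)) = [m'](Θ_{t−2}e_{≥t−1}GF(W_{t−1}(links)))` (charge triples all pass through `b`);
* `coeff_ladder_triple` — **`[m] L_t(𝒳,𝒵) = [m'] L_{t−1}(upFam b 𝒳, upFam b 𝒵)`** (`t ≥ 2`);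
* `coeff_ladder_nonneg_of_triple` — hence `(L_{t−1})` for all `(t−1)`-live pairs gives `(L_t)` at every profile with a tripled point.
With `…LadderSqfreeT` (no doubled point) and `…LadderRowTopT` (`≥ 2t−1` doubled points, exponents `≥ 4`), `(L_t)` for all `t` is reduced to
the profiles `m ≤ 2` with `1 ≤ #(dbl m) ≤ 2t − 2` (memo g26 §3–4).  Nothing is asserted about the crux.
-/

namespace Summit.CriticalPhenomena.PercolationContinuityZ3.Theorems.SahiCTCForms

open Finset MvPolynomial SahiCTCGenFun SahiCTCWeightedLYM

variable {α : Type*} [DecidableEq α] [Fintype α]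

/-- The link of `𝒳` at `b` as a family of the same type: `{U : U ∪ {b} ∈ 𝒳}`. [this work] -/
def upFam (b : α) (𝒳 : Finset (Finset α)) : Finset (Finset α) := univ.powerset.filter fun U => insert b U ∈ 𝒳

section UpFam
variable {𝒳 𝒵 : Finset (Finset α)} {b : α}

/-- Membership in `upFam`. [this work] -/
theorem mem_upFam {U : Finset α} : U ∈ upFam b 𝒳 ↔ insert b U ∈ 𝒳 := by
  unfold upFam; rw [mem_filter, mem_powerset]; exact ⟨fun h => h.2, fun h => ⟨subset_univ _, h⟩⟩

/-- `upFam` of an up-set is an up-set. [this work] -/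
theorem isUpperSet_upFam (h𝒳 : IsUpperSet (𝒳 : Set (Finset α))) : IsUpperSet (upFam b 𝒳 : Set (Finset α)) := by
  intro U U' hUU' hU
  rw [Finset.mem_coe, mem_upFam] at hU ⊢
  exact h𝒳 (insert_subset_insert b hUU') hU

/-- `upFam` of a `t`-live family is `(t−1)`-live. [this work] -/
theorem upFam_live {t : ℕ} (hXt : ∀ S ∈ 𝒳, t ≤ #S) : ∀ S ∈ upFam b 𝒳, t - 1 ≤ #S := fun S hS => by
  have h := hXt _ (mem_upFam.1 hS)
  have := card_insert_le b S
  omega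

/-- `upFam` commutes with intersection. [this work] -/
theorem upFam_inter : upFam b (𝒳 ∩ 𝒵) = upFam b 𝒳 ∩ upFam b 𝒵 := by
  ext U; simp only [mem_upFam, mem_inter]

/-- The common `(t−1)`-sets of the links. [this work] -/
theorem upFam_inter_filter (t : ℕ) :
    (upFam b 𝒳 ∩ upFam b 𝒵).filter (fun S => #S = t - 1) = (upFam b (𝒳 ∩ 𝒵)).filter fun S => #S = t - 1 := by
  rw [upFam_inter]

/-- Traces of the link = traces with `b` moved into the base. [this work] -/
theorem tr_upFam (D s : Finset α) : tr (upFam b 𝒳) D s = tr 𝒳 (insert b D) s := by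
  ext U; rw [mem_tr, mem_tr, mem_upFam, Finset.insert_union]

/-- Kleitman surplus of the links = surplus with `b` in the base. [this work] -/
theorem kap_upFam (D s : Finset α) : kap (upFam b 𝒳) (upFam b 𝒵) D s = kap 𝒳 𝒵 (insert b D) s := by
  unfold kap; rw [tr_upFam, tr_upFam]

end UpFam

/-! ### Profiles with a tripled point `b`: `m` versus `m' = m − 3·1_b` -/

section Triple
variable {𝒳 𝒵 : Finset (Finset α)} {b : α} {m : α →₀ ℕ} {t : ℕ}

omit [Fintype α] in
/-- Values of `m − 3·1_b`. [this work] -/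
theorem sub_single_apply (hb : m b = 3) (i : α) : (m - (Finsupp.single b 3 : α →₀ ℕ)) i = if i = b then 0 else m i := by
  rw [Finsupp.tsub_apply, Finsupp.single_apply]
  by_cases hi : i = b
  · subst hi; simp [hb]
  · rw [if_neg (fun h => hi h.symm), if_neg hi]; omega

omit [Fintype α] in
/-- `1_{E'} ≤ m − 3·1_b` forces `b ∉ E'`. [this work] -/
theorem not_mem_of_ind_le_sub (hb : m b = 3) {E' : Finset α} (h : ind E' ≤ m - (Finsupp.single b 3 : α →₀ ℕ)) : b ∉ E' := fun hbE => by
  have := h b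
  rw [ind_apply, if_pos hbE, sub_single_apply hb, if_pos rfl] at this
  omega

omit [Fintype α] in
/-- `1_{E∖b}` pointwise. [this work] -/
theorem ind_erase_apply (E : Finset α) (b i : α) : ind (E.erase b) i = if i = b then 0 else ind E i := by
  rw [ind_apply, ind_apply]
  by_cases hi : i = b
  · subst hi; simp
  · simp [hi, mem_erase]

omit [Fintype α] in
/-- `1_E ≤ m` with `b ∈ E` iff `1_{E∖b} ≤ m − 3·1_b` (given `m b = 3`). [this work] -/
theorem ind_erase_le_iff (hb : m b = 3) {E : Finset α} (hbE : b ∈ E) :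
    ind (E.erase b) ≤ m - (Finsupp.single b 3 : α →₀ ℕ) ↔ ind E ≤ m := by
  constructor
  · intro h i
    by_cases hi : i = b
    · subst hi; rw [ind_apply, if_pos hbE]; omega
    · have := h i
      rw [ind_erase_apply, sub_single_apply hb, if_neg hi, if_neg hi] at this
      exact this
  · intro h i
    rw [ind_erase_apply, sub_single_apply hb]
    by_cases hi : i = b
    · rw [if_pos hi, if_pos hi]
    · rw [if_neg hi, if_neg hi]; exact h i

omit [Fintype α] in
/-- The residual profiles `m − 1_E` and `m' − 1_{E∖b}` agree off `b`; at `b` they are `2` and `0`. [this work] -/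
theorem residual_apply (hb : m b = 3) (E : Finset α) (i : α) :
    (m - (Finsupp.single b 3 : α →₀ ℕ) - ind (E.erase b)) i = if i = b then 0 else (m - ind E) i := by
  simp only [Finsupp.tsub_apply, sub_single_apply hb, ind_erase_apply]
  by_cases hi : i = b
  · simp [hi]
  · simp [hi]

omit [Fintype α] in
/-- At `b` the residual profile of `m` is `2`. [this work] -/
theorem residual_apply_b (hb : m b = 3) {E : Finset α} (hbE : b ∈ E) : (m - ind E) b = 2 := by
  rw [SahiAllButC.tsub_ind_apply, if_pos hbE, hb]

omit [Fintype α] in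
/-- `m − 1_E ≤ 2` iff `m' − 1_{E∖b} ≤ 2`. [this work] -/
theorem residual_le_two_iff (hb : m b = 3) {E : Finset α} (hbE : b ∈ E) :
    (∀ i, (m - ind E) i ≤ 2) ↔ ∀ i, (m - (Finsupp.single b 3 : α →₀ ℕ) - ind (E.erase b)) i ≤ 2 := by
  constructor
  · intro h i
    rw [residual_apply hb E]
    by_cases hi : i = b
    · rw [if_pos hi]; omega
    · rw [if_neg hi]; exact h i
  · intro h i
    by_cases hi : i = b
    · subst hi; rw [residual_apply_b hb hbE]
    · have := h i; rw [residual_apply hb E, if_neg hi] at this; exact this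

omit [Fintype α] in
/-- Doubled sets: `dbl (m − 1_E) = insert b (dbl (m' − 1_{E∖b}))`. [this work] -/
theorem dbl_residual (hb : m b = 3) {E : Finset α} (hbE : b ∈ E) :
    dbl (m - ind E) = insert b (dbl (m - (Finsupp.single b 3 : α →₀ ℕ) - ind (E.erase b))) := by
  ext i
  rw [dbl, mem_filter, Finsupp.mem_support_iff, mem_insert, dbl, mem_filter, Finsupp.mem_support_iff, residual_apply hb E]
  by_cases hi : i = b
  · subst hi; rw [residual_apply_b hb hbE]; simp
  · rw [if_neg hi]; simp [hi]

omit [Fintype α] in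
/-- `b` is not doubled in `m' − 1_{E∖b}`. [this work] -/
theorem not_mem_dbl_residual (hb : m b = 3) (E : Finset α) : b ∉ dbl (m - (Finsupp.single b 3 : α →₀ ℕ) - ind (E.erase b)) := by
  rw [dbl, mem_filter, residual_apply hb E, if_pos rfl]; omega

omit [Fintype α] in
/-- Single sets agree: `sgl (m − 1_E) = sgl (m' − 1_{E∖b})`. [this work] -/
theorem sgl_residual (hb : m b = 3) {E : Finset α} (hbE : b ∈ E) :
    sgl (m - ind E) = sgl (m - (Finsupp.single b 3 : α →₀ ℕ) - ind (E.erase b)) := by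
  ext i
  rw [sgl, mem_sdiff, dbl, mem_filter, Finsupp.mem_support_iff, sgl, mem_sdiff, dbl, mem_filter, Finsupp.mem_support_iff,
    residual_apply hb E]
  by_cases hi : i = b
  · subst hi; rw [residual_apply_b hb hbE]; simp
  · rw [if_neg hi]

/-- **Harris coefficients**: `[m − 1_E] H(𝒳,𝒵) = [m' − 1_{E∖b}] H(upFam b 𝒳, upFam b 𝒵)` for `b ∈ E`. [this work] -/
theorem coeff_harris_triple_residual (hb : m b = 3) {E : Finset α} (hbE : b ∈ E) :
    (PiP * gf (𝒳 ∩ 𝒵) - gf 𝒳 * gf 𝒵).coeff (m - ind E) =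
      (PiP * gf (upFam b 𝒳 ∩ upFam b 𝒵) - gf (upFam b 𝒳) * gf (upFam b 𝒵)).coeff (m - (Finsupp.single b 3 : α →₀ ℕ) - ind (E.erase b)) := by
  by_cases h2 : ∀ i, (m - ind E) i ≤ 2
  · rw [coeff_harrisForm_eq_kap _ _ h2, coeff_harrisForm_eq_kap _ _ ((residual_le_two_iff hb hbE).1 h2), kap_upFam,
      dbl_residual hb hbE, sgl_residual hb hbE]
  · rw [coeff_harrisForm_eq_zero _ _ h2, coeff_harrisForm_eq_zero _ _ (fun h => h2 ((residual_le_two_iff hb hbE).2 h))]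

/-- **The surplus side passes to the links**: `[m](e_t·H(𝒳,𝒵)) = [m'](e_{t−1}·H(upFam b 𝒳, upFam b 𝒵))` (`m b = 3`, `t ≥ 1`). [this work] -/
theorem coeff_ee_mul_harris_triple (ht : 1 ≤ t) (hb : m b = 3) :
    (ee t * (PiP * gf (𝒳 ∩ 𝒵) - gf 𝒳 * gf 𝒵)).coeff m =
      (ee (t - 1) * (PiP * gf (upFam b 𝒳 ∩ upFam b 𝒵) - gf (upFam b 𝒳) * gf (upFam b 𝒵))).coeff (m - (Finsupp.single b 3 : α →₀ ℕ)) := by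
  rw [coeff_ee_mul, coeff_ee_mul]
  -- the t-sets avoiding b contribute 0
  rw [← sum_filter_add_sum_filter_not _ (fun E => b ∈ E)]
  have hzero : ∑ E ∈ ((bySize (· = t) : Finset (Finset α)).filter (fun E => ind E ≤ m)).filter (fun E => ¬ b ∈ E),
      (PiP * gf (𝒳 ∩ 𝒵) - gf 𝒳 * gf 𝒵).coeff (m - ind E) = 0 := by
    refine sum_eq_zero fun E hE => coeff_harrisForm_eq_zero _ _ fun h => ?_
    have hbE := (mem_filter.1 hE).2
    have := h b
    rw [SahiAllButC.tsub_ind_apply, if_neg hbE, hb] at this; omega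
  rw [hzero, add_zero]
  refine sum_bij' (fun E _ => E.erase b) (fun E' _ => insert b E') (fun E hE => ?_) (fun E' hE' => ?_) (fun E hE => ?_) (fun E' hE' => ?_)
    (fun E hE => coeff_harris_triple_residual hb (mem_filter.1 hE).2)
  · obtain ⟨hE', hbE⟩ := mem_filter.1 hE
    obtain ⟨hEt, hEm⟩ := mem_filter.1 hE'
    have hEt' : #E = t := (mem_filter.1 hEt).2
    refine mem_filter.2 ⟨mem_filter.2 ⟨mem_powerset.2 (subset_univ _), ?_⟩, (ind_erase_le_iff hb hbE).2 hEm⟩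
    rw [card_erase_of_mem hbE, hEt']
  · obtain ⟨hEt, hEm⟩ := mem_filter.1 hE'
    have hEt' : #E' = t - 1 := (mem_filter.1 hEt).2
    have hbE' : b ∉ E' := not_mem_of_ind_le_sub hb hEm
    refine mem_filter.2 ⟨mem_filter.2 ⟨mem_filter.2 ⟨mem_powerset.2 (subset_univ _), ?_⟩, ?_⟩, mem_insert_self b E'⟩
    · rw [card_insert_of_notMem hbE', hEt']; omega
    · rw [← ind_erase_le_iff hb (mem_insert_self b E'), erase_insert hbE']; exact hEm
  · exact insert_erase (mem_filter.1 hE).2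
  · exact erase_insert (not_mem_of_ind_le_sub hb (mem_filter.1 hE').2)

/-- **The charge side passes to the links**: `[m](Θ_{t−1}e_{≥t}GF(W_t)) = [m'](Θ_{t−2}e_{≥t−1}GF(W_{t−1}(links)))` (`m b = 3`, `t ≥ 2`). [this work] -/
theorem coeff_charge_triple (ht : 2 ≤ t) (hb : m b = 3) :
    (gf (bySize (· ≤ t - 1) : Finset (Finset α)) * gf (bySize (t ≤ ·) : Finset (Finset α)) *
        gf ((𝒳 ∩ 𝒵).filter fun S => #S = t)).coeff m =
      (gf (bySize (· ≤ t - 1 - 1) : Finset (Finset α)) * gf (bySize (t - 1 ≤ ·) : Finset (Finset α)) *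
        gf ((upFam b 𝒳 ∩ upFam b 𝒵).filter fun S => #S = t - 1)).coeff (m - (Finsupp.single b 3 : α →₀ ℕ)) := by
  rw [coeff_chargeT_eq_sum, coeff_chargeT_eq_sum, ← upFam_inter]
  rw [← sum_filter_add_sum_filter_not _ (fun w => b ∈ w)]
  have hzero : ∑ w ∈ (((𝒳 ∩ 𝒵).filter fun S => #S = t).filter (fun w => ind w ≤ m)).filter (fun w => ¬ b ∈ w),
      (gf (bySize (· ≤ t - 1) : Finset (Finset α)) * gf (bySize (t ≤ ·) : Finset (Finset α))).coeff (m - ind w) = 0 := by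
    refine sum_eq_zero fun w hw => coeff_thetaT_mul_atLeastT_eq_zero t fun h => ?_
    have hbw := (mem_filter.1 hw).2
    have := h b
    rw [SahiAllButC.tsub_ind_apply, if_neg hbw, hb] at this; omega
  rw [hzero, add_zero]
  refine sum_bij' (fun w _ => w.erase b) (fun w' _ => insert b w') (fun w hw => ?_) (fun w' hw' => ?_) (fun w hw => ?_) (fun w' hw' => ?_)
    (fun w hw => ?_)
  · obtain ⟨hw', hbw⟩ := mem_filter.1 hw
    obtain ⟨hwt, hwm⟩ := mem_filter.1 hw'
    obtain ⟨hwXZ, hwt'⟩ := mem_filter.1 hwt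
    refine mem_filter.2 ⟨mem_filter.2 ⟨mem_upFam.2 (by rw [insert_erase hbw]; exact hwXZ), ?_⟩, (ind_erase_le_iff hb hbw).2 hwm⟩
    rw [card_erase_of_mem hbw, hwt']
  · obtain ⟨hwt, hwm⟩ := mem_filter.1 hw'
    obtain ⟨hwXZ, hwt'⟩ := mem_filter.1 hwt
    have hbw' : b ∉ w' := not_mem_of_ind_le_sub hb hwm
    refine mem_filter.2 ⟨mem_filter.2 ⟨mem_filter.2 ⟨mem_upFam.1 hwXZ, ?_⟩, ?_⟩, mem_insert_self b w'⟩
    · rw [card_insert_of_notMem hbw', hwt']; omega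
    · rw [← ind_erase_le_iff hb (mem_insert_self b w'), erase_insert hbw']; exact hwm
  · exact insert_erase (mem_filter.1 hw).2
  · exact erase_insert (not_mem_of_ind_le_sub hb (mem_filter.1 hw').2)
  · -- the charge factors agree
    have hbw := (mem_filter.1 hw).2
    by_cases h2 : ∀ i, (m - ind w) i ≤ 2
    · rw [coeff_thetaT_mul_atLeastT_eq_cH (by omega) h2, coeff_thetaT_mul_atLeastT_eq_cH (by omega) ((residual_le_two_iff hb hbw).1 h2),
        dbl_residual hb hbw, sgl_residual hb hbw, card_insert_of_notMem (not_mem_dbl_residual hb w)]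
      congr 2; omega
    · rw [coeff_thetaT_mul_atLeastT_eq_zero _ h2,
        coeff_thetaT_mul_atLeastT_eq_zero _ (fun h => h2 ((residual_le_two_iff hb hbw).2 h))]

/-- **A tripled point is the lower level** (memo g26 Theorem C): for `t ≥ 2`, up-sets `𝒳, 𝒵` and a profile `m` with `m b = 3`,
`[m] L_t(𝒳,𝒵) = [m − 3·1_b] L_{t−1}(upFam b 𝒳, upFam b 𝒵)`. [this work] -/
theorem coeff_ladder_triple (ht : 2 ≤ t) (hb : m b = 3) :
    (ee t * (PiP * gf (𝒳 ∩ 𝒵) - gf 𝒳 * gf 𝒵) -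
      gf (bySize (· ≤ t - 1) : Finset (Finset α)) * gf (bySize (t ≤ ·) : Finset (Finset α)) *
        gf ((𝒳 ∩ 𝒵).filter fun S => #S = t)).coeff m =
    (ee (t - 1) * (PiP * gf (upFam b 𝒳 ∩ upFam b 𝒵) - gf (upFam b 𝒳) * gf (upFam b 𝒵)) -
      gf (bySize (· ≤ t - 1 - 1) : Finset (Finset α)) * gf (bySize (t - 1 ≤ ·) : Finset (Finset α)) *
        gf ((upFam b 𝒳 ∩ upFam b 𝒵).filter fun S => #S = t - 1)).coeff (m - (Finsupp.single b 3 : α →₀ ℕ)) := by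
  rw [coeff_sub, coeff_sub, coeff_ee_mul_harris_triple (by omega) hb, coeff_charge_triple ht hb]

/-- **`(L_{t−1}) ⇒ (L_t)` at every profile with a tripled point**: if the ladder form of level `t − 1` has nonnegative coefficients for
every pair of `(t−1)`-live up-sets, then for `t`-live up-sets `𝒳, 𝒵` and every profile `m` with some `m b = 3` the coefficient of `L_t` at
`m` is nonnegative (`t ≥ 2`). [this work] -/
theorem coeff_ladder_nonneg_of_triple (ht : 2 ≤ t)
    (hL : ∀ (𝒳' 𝒵' : Finset (Finset α)), IsUpperSet (𝒳' : Set (Finset α)) → IsUpperSet (𝒵' : Set (Finset α)) →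
      (∀ S ∈ 𝒳', t - 1 ≤ #S) → (∀ S ∈ 𝒵', t - 1 ≤ #S) → ∀ m' : α →₀ ℕ,
        0 ≤ (ee (t - 1) * (PiP * gf (𝒳' ∩ 𝒵') - gf 𝒳' * gf 𝒵') -
          gf (bySize (· ≤ t - 1 - 1) : Finset (Finset α)) * gf (bySize (t - 1 ≤ ·) : Finset (Finset α)) *
            gf ((𝒳' ∩ 𝒵').filter fun S => #S = t - 1)).coeff m')
    (h𝒳 : IsUpperSet (𝒳 : Set (Finset α))) (h𝒵 : IsUpperSet (𝒵 : Set (Finset α))) (hXt : ∀ S ∈ 𝒳, t ≤ #S)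
    (hZt : ∀ S ∈ 𝒵, t ≤ #S) (hb : m b = 3) :
    0 ≤ (ee t * (PiP * gf (𝒳 ∩ 𝒵) - gf 𝒳 * gf 𝒵) -
      gf (bySize (· ≤ t - 1) : Finset (Finset α)) * gf (bySize (t ≤ ·) : Finset (Finset α)) *
        gf ((𝒳 ∩ 𝒵).filter fun S => #S = t)).coeff m := by
  rw [coeff_ladder_triple ht hb]
  exact hL _ _ (isUpperSet_upFam h𝒳) (isUpperSet_upFam h𝒵) (upFam_live hXt) (upFam_live hZt) _

end Triple

end Summit.CriticalPhenomena.PercolationContinuityZ3.Theorems.SahiCTCForms
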